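import Mathlib
import Literature.NumberTheory.LFunctions.Zhang2022.Section8AdmissibleRectangle
import Literature.NumberTheory.LFunctions.Zhang2022.Section8Eq81aResidue
import Literature.NumberTheory.LFunctions.Zhang2022.SkeletonProp22W
import Literature.NumberTheory.LFunctions.Zhang2022.Section8Step8u016
import HarnessLib

/-!
# Zhang (2022) §8 p. 42: the Proposition-2.2 inputs of the proof of Lemma 8.1 — `Z22:§8.u003`
# (the admissible rectangle) and `Z22:(8.1)`a (the residue identity) — from the WINDOWED Prop. 2.2

Topic `Literature/NumberTheory/LFunctions/Zhang2022` (Landau–Siegel adjudication tree;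
verdict-neutral). Y. Zhang, *Discrete mean estimates and the Landau–Siegel zero*,
arXiv:2211.02515v1 (2022) [Zhang2022LandauSiegel] — an unrefereed manuscript under adjudication.
DAG node `Z22:§8.u003` [Z22 p.42, tex L2197–L2201]: "By Proposition 2.2, we can choose a rectangle
`ℜ` with vertices at `s₀ ± α + i𝓛₁^{±}` such that `𝓛₁^{±} = ±𝓛₁ + O(α)` and such that the set of zeros
of `L(s,ψ)` inside `ℜ` is exactly `𝒵(ψ)` … `|s − ρ| ≫ α`".

`Section8AdmissibleRectangle.lean` (p414231) proves `Section8aStatements.Step8u003`, and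
`Section8Eq81aResidue.lean` (p414494) proves `Section8aStatements.Eq81a c′`, from the banked
`Skeleton.Prop22 c′`. After the cell's ruling on the §4 seams (`SkeletonProp22W.lean`, p414559)
the node of record is `Skeleton.Prop22W c′`, whose gap assertion (iii) only covers consecutive pairs
with the LOWER zero in `|γ − 2πt₀| < 𝓛₁ + 3/2`; the consumer of `Step8u003` becomes
`Skeleton.Ded81W c′ := Prop22W c′ → … → Lemma81 c′`. The choice of `ℜ` only needs the spacing of
the zeros within `𝓛₁ + 1` of `2πt₀` (the heights `𝓛₁^{±}` are within `α/8` of `±𝓛₁`; a zero of `Ω`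
in the outer band `𝓛₁ + 1 ≤ |γ − 2πt₀| < 𝓛₁ + 2` is `≥ 1 − α/8 ≥ α/8` away from `∂ℜ` anyway), so
the windowed form suffices. This file PROVES

* `admRect_of_prop22W_at` — the admissible rectangle (`C = 1`, `c₀ = 1/8`) at one character from
  (i) and the windowed (iii) there (same construction as `admRect_of_prop22_at`, heights taken over
  the zeros in the inner band `|γ − 2πt₀| < 𝓛₁ + 1`);
* `step8u003_of_prop22W : 0 ≤ c′ → Skeleton.Prop22W c′ → Step8u003`;
* `eq81a_of_prop22ii : 0 ≤ c′ → Skeleton.Prop22ii → Eq81a c′` (the residue identity uses only the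
  simplicity of the zeros) and `eq81a_of_prop22W : 0 ≤ c′ → Skeleton.Prop22W c′ → Eq81a c′`.

No new definitions, no named facts; nothing here bears on Theorems 1–2 of the source or on the
cell's verdict on (8.24). Cell siegel-zhang (D-0069), cone C19 (`Ded81W`).

## References

* Y. Zhang, arXiv:2211.02515v1 (2022), §8, proof of Lemma 8.1, p. 42 (tex L2197–L2201); §2
  Proposition 2.2 p. 7. [cite: Zhang2022LandauSiegel, §8 p. 42]
-/

noncomputable section

open Complex Real Set

namespace Literature.NumberTheory.LFunctions.Zhang2022.Section8aStatements

open Literature.NumberTheory.LFunctions.Zhang2022 Skeleton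

/-- Every point of a finite `S ⊆ ℂ` above a windowed `s ∈ S` is higher than `Im s + a − e`
when the consecutive-gap bound holds for lower zeros in the window (a private copy of
`Skeleton.im_gt_of_gapW` of `Section2Lemma23Window.lean`, to keep this file's imports minimal).
[cite: Zhang2022LandauSiegel, §2 Prop. 2.2 (iii) p. 7] -/
private theorem im_gt_of_gapW' {S : Set ℂ} (hS : S.Finite) {a e T W : ℝ}
    (hgap : ∀ s ∈ S, ∀ s' ∈ S, |s.im - T| < W → s.im < s'.im →
      (∀ s'' ∈ S, ¬ (s.im < s''.im ∧ s''.im < s'.im)) → |s'.im - s.im - a| < e)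
    {s z : ℂ} (hs : s ∈ S) (hsW : |s.im - T| < W) (hz : z ∈ S) (hsz : s.im < z.im) :
    s.im + a - e < z.im := by
  obtain ⟨w, hw, hlt, hmin⟩ := exists_next_above hS hz hsz
  have h := hgap s hs w hw hsW hlt (fun u hu hu' => (not_le.mpr hu'.2) (hmin u hu hu'.1))
  rw [abs_lt] at h
  exact lt_of_lt_of_le (by linarith [h.1]) (hmin z hz hsz)

section Setting

variable {D : ℕ} [NeZero D] (χ : DirichletCharacter ℂ D)

/-- **`Z22:§8.u003` at one character, from the WINDOWED Proposition 2.2 at that character**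
(p. 42): for `D ≥ 3`, `χ` primitive, `c′ ≥ 0` with `5c′α𝓛 < 1` and `α ≤ 1/8`, if the zeros of
`L(s,ψ)L(s,ψχ)` in `Ω` lie on the critical line ((i)) and have consecutive gaps within `c′α²𝓛` of `α`
whenever the lower zero is in the inner window `|γ − 2πt₀| < 𝓛₁ + 3/2` ((iii), windowed), then there
are heights `𝓛₁⁻, 𝓛₁⁺` with `AdmRect D x 1 (1/8) 𝓛₁⁻ 𝓛₁⁺` (the heights are chosen against the zeros
of the inner band `|γ − 2πt₀| < 𝓛₁ + 1`; outer-band zeros are `≥ 1 − α/8` from `∂ℜ`).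
[cite: Zhang2022LandauSiegel, §8 p. 42, tex L2197–L2201] -/
theorem admRect_of_prop22W_at (hD : 3 ≤ D) (hχ : χ.IsPrimitive) {c' : ℝ} (hc' : 0 ≤ c')
    (hsmall : 5 * c' * alpha D * ell D < 1) (hα8 : alpha D ≤ 1 / 8) (x : Chr D)
    (h_i : ∀ s ∈ prodZeroSetOmega χ x, s.re = 1 / 2)
    (h_iii : ∀ s ∈ prodZeroSetOmega χ x, ∀ s' ∈ prodZeroSetOmega χ x,
      |s.im - 2 * π * t0 D| < ell1 D + 3 / 2 → s.im < s'.im →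
        (∀ s'' ∈ prodZeroSetOmega χ x, ¬ (s.im < s''.im ∧ s''.im < s'.im)) →
          |s'.im - s.im - alpha D| < c' * alpha D ^ 2 * ell D) :
    ∃ Lm Lp : ℝ, AdmRect D x 1 (1 / 8) Lm Lp := by
  -- parameters
  have hα : 0 < alpha D := by
    rw [alpha, bigP, Real.log_exp]
    exact div_pos Real.pi_pos (pow_pos (by linarith [one_lt_ell hD]) _)
  have hℓ : 1 < ell D := one_lt_ell hD
  have he : 0 ≤ c' * alpha D ^ 2 * ell D := by positivity
  have heα : c' * alpha D ^ 2 * ell D ≤ alpha D / 2 := by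
    have : c' * alpha D ^ 2 * ell D = alpha D * (c' * alpha D * ell D) := by ring
    rw [this]; nlinarith
  -- the heights of the zeros of `L(s,ψ)L(s,ψχ)` in `Ω`, a finite set, pairwise `> α/2` apart
  set S : Set ℂ := prodZeroSetOmega χ x with hS_def
  have hSfin : S.Finite := prodZeroSetOmega_finite χ hD hχ x
  set S₁ : Set ℂ := S ∩ {s | |s.im - 2 * π * t0 D| < ell1 D + 1} with hS₁_def
  set H : Set ℝ := (fun s : ℂ => s.im - 2 * π * t0 D) '' S₁ with hH_def
  have hHfin : H.Finite := (hSfin.subset Set.inter_subset_left).image _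
  have hsep : ∀ h ∈ H, ∀ h' ∈ H, h < h' → alpha D / 2 < h' - h := by
    rintro _ ⟨s, ⟨hs, hsW⟩, rfl⟩ _ ⟨s', ⟨hs', -⟩, rfl⟩ hlt
    have hsW' : |s.im - 2 * π * t0 D| < ell1 D + 3 / 2 := lt_of_lt_of_le hsW (by linarith)
    have h := im_gt_of_gapW' hSfin h_iii hs hsW' hs' (by linarith)
    linarith
  obtain ⟨Lp, hLp1, hLp2, hLp3⟩ := exists_top_height hHfin (ell1 D) hα hsep
  obtain ⟨Lm, hLm1, hLm2, hLm3⟩ := exists_bottom_height hHfin (-ell1 D) hα hsep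
  refine ⟨Lm, Lp, ?_, ?_, ?_, ?_⟩
  · -- `|𝓛₁⁺ − 𝓛₁| ≤ α`
    linarith [abs_nonneg (Lp - ell1 D)]
  · -- `|𝓛₁⁻ + 𝓛₁| ≤ α`
    rw [show Lm + ell1 D = Lm - -ell1 D by ring]
    linarith [abs_nonneg (Lm - -ell1 D)]
  · -- the zeros of `L(s,ψ)` inside `ℜ` are exactly `𝒵(ψ)`
    ext ρ
    simp only [Set.mem_setOf_eq, rectR, zeroSet]
    constructor
    · rintro ⟨hL, hre, hlo, hhi⟩
      have hΩ : ρ ∈ Omega D := by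
        refine ⟨?_, ?_⟩
        · rw [Complex.sub_re, s0_re]; linarith [abs_nonneg (ρ.re - 1 / 2)]
        · rw [Complex.sub_im, s0_im, abs_lt]
          have h1 := abs_le.mp hLp1
          have h2 := abs_le.mp hLm1
          constructor <;> linarith
      have hρS : ρ ∈ S := ⟨hΩ, by rw [hL, zero_mul]⟩
      have hh : ρ.im - 2 * π * t0 D ∈ H := by
        refine ⟨ρ, ⟨hρS, ?_⟩, rfl⟩
        have h1 := abs_le.mp hLp1
        have h2 := abs_le.mp hLm1
        show |ρ.im - 2 * π * t0 D| < ell1 D + 1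
        rw [abs_lt]; constructor <;> linarith
      have htop := (hLp3 _ hh).mp (by linarith)
      have hbot := (hLm3 _ hh).mp (by linarith)
      refine ⟨lt_of_le_of_lt hre.le (by linarith), ?_, hL⟩
      rw [abs_lt]; constructor <;> linarith
    · rintro ⟨hre, him, hL⟩
      have hρS : ρ ∈ S := mem_prodZeroSetOmega_of_mem_zeroSet χ ⟨hre, him, hL⟩
      have hre' : ρ.re = 1 / 2 := h_i ρ hρS
      have hh : ρ.im - 2 * π * t0 D ∈ H :=
        ⟨ρ, ⟨hρS, show |ρ.im - 2 * π * t0 D| < ell1 D + 1 from lt_of_lt_of_le him (by linarith)⟩,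
          rfl⟩
      have him' := abs_lt.mp him
      have htop := (hLp3 _ hh).mpr (by linarith)
      have hbot := (hLm3 _ hh).mpr (by linarith)
      refine ⟨hL, by rw [hre', sub_self, abs_zero]; exact hα, by linarith, by linarith⟩
  · -- every zero of `L(s,ψ)` is at distance `≥ α/8` from `∂ℜ`
    intro s hs ρ hL
    obtain ⟨⟨hsre, hslo, hshi⟩, hsnot⟩ := hs
    have hre_le : |(s - ρ).re| ≤ ‖s - ρ‖ := Complex.abs_re_le_norm _
    have him_le : |(s - ρ).im| ≤ ‖s - ρ‖ := Complex.abs_im_le_norm _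
    rw [Complex.sub_re] at hre_le
    rw [Complex.sub_im] at him_le
    by_cases hbox : |ρ.re - 1 / 2| < 1 / 2 ∧ |ρ.im - 2 * π * t0 D| < ell1 D + 2
    · -- `ρ ∈ Ω`: on the critical line, height in `H`
      have hΩ : ρ ∈ Omega D := by
        refine ⟨?_, ?_⟩
        · rw [Complex.sub_re, s0_re]; exact hbox.1
        · rw [Complex.sub_im, s0_im]; exact hbox.2
      have hρS : ρ ∈ S := ⟨hΩ, by rw [hL, zero_mul]⟩
      have hre' : ρ.re = 1 / 2 := h_i ρ hρS
      by_cases hin : |ρ.im - 2 * π * t0 D| < ell1 D + 1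
      swap
      · -- a zero of `Ω` in the outer band `𝓛₁ + 1 ≤ |γ − 2πt₀| < 𝓛₁ + 2`: far from `∂ℜ` vertically
        rw [not_lt] at hin
        have hLp := abs_le.mp hLp1
        have hLm := abs_le.mp hLm1
        have h1 : ell1 D + 1 - (ell1 D + alpha D / 8) ≤ |s.im - ρ.im| := by
          have := abs_sub_abs_le_abs_sub (ρ.im - 2 * π * t0 D) (s.im - 2 * π * t0 D)
          rw [show ρ.im - 2 * π * t0 D - (s.im - 2 * π * t0 D) = -(s.im - ρ.im) by ring,
            abs_neg] at this
          have h3 : |s.im - 2 * π * t0 D| ≤ ell1 D + alpha D / 8 := by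
            rw [abs_le]; constructor <;> linarith
          linarith
        linarith
      have hh : ρ.im - 2 * π * t0 D ∈ H := ⟨ρ, ⟨hρS, hin⟩, rfl⟩
      by_cases hvert : |s.re - 1 / 2| = alpha D
      · -- on a vertical edge: horizontal distance `α`
        have : alpha D ≤ |s.re - ρ.re| := by rw [hre', hvert]
        linarith
      · -- on a horizontal edge: vertical distance `≥ α/8` by the choice of the heights
        have hlt : |s.re - 1 / 2| < alpha D := lt_of_le_of_ne hsre hvert
        have hedge : s.im = 2 * π * t0 D + Lp ∨ s.im = 2 * π * t0 D + Lm := by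
          by_contra hne
          push Not at hne
          apply hsnot
          exact ⟨hlt, lt_of_le_of_ne hslo (fun h => hne.2 h.symm), lt_of_le_of_ne hshi hne.1⟩
        rcases hedge with hsim | hsim
        · have h2 := hLp2 _ hh
          rw [show ρ.im - 2 * π * t0 D - Lp = -(s.im - ρ.im) by rw [hsim]; ring, abs_neg] at h2
          linarith
        · have h2 := hLm2 _ hh
          rw [show ρ.im - 2 * π * t0 D - Lm = -(s.im - ρ.im) by rw [hsim]; ring, abs_neg] at h2
          linarith
    · -- `ρ ∉ Ω`: far from the rectangle
      rw [not_and_or, not_lt, not_lt] at hbox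
      rcases hbox with hfar | hfar
      · -- `|Re ρ − ½| ≥ ½` while `|Re s − ½| ≤ α ≤ 1/8`
        have h1 : 1 / 2 - alpha D ≤ |s.re - ρ.re| := by
          have := abs_sub_abs_le_abs_sub (ρ.re - 1 / 2) (s.re - 1 / 2)
          rw [show ρ.re - 1 / 2 - (s.re - 1 / 2) = -(s.re - ρ.re) by ring, abs_neg] at this
          linarith
        linarith
      · -- `|Im ρ − 2πt₀| ≥ 𝓛₁ + 2` while `Im s` is within `𝓛₁ + α/8` of `2πt₀`
        have hLp := abs_le.mp hLp1
        have hLm := abs_le.mp hLm1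
        have h1 : ell1 D + 2 - (ell1 D + alpha D / 8) ≤ |s.im - ρ.im| := by
          have := abs_sub_abs_le_abs_sub (ρ.im - 2 * π * t0 D) (s.im - 2 * π * t0 D)
          rw [show ρ.im - 2 * π * t0 D - (s.im - 2 * π * t0 D) = -(s.im - ρ.im) by ring,
            abs_neg] at this
          have h3 : |s.im - 2 * π * t0 D| ≤ ell1 D + alpha D / 8 := by
            rw [abs_le]; constructor <;> linarith
          linarith
        linarith

end Setting

/-! ## `Z22:§8.u003` from the windowed Proposition 2.2, for all large `D` -/

/-- `L₀ ≤ log D` once `D ≥ ⌈exp L₀⌉₊`. [folklore] -/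
private theorem u003W_threshold_le_ell {L₀ : ℝ} {D : ℕ} (hD : ⌈Real.exp L₀⌉₊ ≤ D) : L₀ ≤ ell D := by
  have h : Real.exp L₀ ≤ D := le_trans (Nat.le_ceil _) (by exact_mod_cast hD)
  exact (Real.le_log_iff_exp_le (lt_of_lt_of_le (Real.exp_pos _) h)).mpr h

/-- The thresholds: `𝓛 ≥ max(2, 5πc′+1)` gives `5c′α𝓛 < 1` and `α ≤ 1/8` (`α = π/𝓛⁹ ≤ π/512`).
[cite: Zhang2022LandauSiegel, §2 (2.10)] -/
private theorem u003W_alpha_small {c' : ℝ} {D : ℕ} (hℓ2 : 2 ≤ ell D) (hℓc : 5 * π * c' + 1 ≤ ell D) :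
    5 * c' * alpha D * ell D < 1 ∧ alpha D ≤ 1 / 8 := by
  have hα : alpha D = π / ell D ^ 9 := by rw [alpha, bigP, Real.log_exp]
  have hℓ9 : (512 : ℝ) ≤ ell D ^ 9 := by
    calc (512 : ℝ) = 2 ^ 9 := by norm_num
      _ ≤ ell D ^ 9 := by gcongr
  refine ⟨?_, ?_⟩
  · have h8 : ell D ≤ ell D ^ 8 := le_self_pow₀ (by linarith) (by norm_num)
    have hkey : 5 * c' * π * ell D < ell D ^ 9 := by
      have h9 : ell D ^ 9 = ell D ^ 8 * ell D := by ring
      rw [h9]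
      have : 5 * π * c' < ell D ^ 8 := by linarith
      nlinarith
    rw [hα]
    calc 5 * c' * (π / ell D ^ 9) * ell D = 5 * c' * π * ell D / ell D ^ 9 := by ring
      _ < 1 := by rw [div_lt_one (by positivity)]; exact hkey
  · rw [hα, div_le_iff₀ (by positivity)]
    nlinarith [Real.pi_lt_four]

/-- **`Z22:§8.u003` HOLDS given the windowed Proposition 2.2** (`Skeleton.Prop22W c′`, (iii) for
lower zeros in `|γ − 2πt₀| < 𝓛₁ + 3/2`): for every `c′ ≥ 0`, `Section8aStatements.Step8u003` with
`C = 1`, `c₀ = 1/8`, for all large `D`. [cite: Zhang2022LandauSiegel, §8 p. 42, tex L2197–L2201] -/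
theorem step8u003_of_prop22W {c' : ℝ} (hc' : 0 ≤ c') (h22 : Skeleton.Prop22W c') : Step8u003 := by
  obtain ⟨h_i, -, h_iii⟩ := h22
  obtain ⟨D₁, h⟩ := h_i.and h_iii
  refine ⟨1, 1 / 8, by norm_num, max (max D₁ 3) ⌈Real.exp (max 2 (5 * π * c' + 1))⌉₊,
    fun D _ χ hD hq hp _ x hx => ?_⟩
  have hD₁ : D₁ ≤ D := le_trans (le_trans (le_max_left _ _) (le_max_left _ _)) hD
  have hD3 : 3 ≤ D := le_trans (le_trans (le_max_right _ _) (le_max_left _ _)) hD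
  have hL := u003W_threshold_le_ell (le_trans (le_max_right _ _) hD)
  obtain ⟨hsmall, hα8⟩ := u003W_alpha_small (le_trans (le_max_left _ _) hL)
    (le_trans (le_max_right _ _) hL)
  obtain ⟨e_i, e_iii⟩ := h D χ hD₁ hq hp
  exact admRect_of_prop22W_at χ hD3 hp hc' hsmall hα8 x (e_i x hx) (e_iii x hx)

/-! ## `Z22:(8.1)`a from Proposition 2.2 (ii) alone, and from the windowed Proposition 2.2 -/

/-- **`Z22:(8.1)`, first equality, from Proposition 2.2 (ii) alone** (the residue identity on an
admissible rectangle needs only the simplicity of the zeros): for every `c′ ≥ 0`,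
`Skeleton.Prop22ii → Section8aStatements.Eq81a c′` (same thresholds and assembly as
`eq81a_of_prop22`, via `eq81a_at`). [cite: Zhang2022LandauSiegel, §8 (8.1) p. 42, tex L2202–L2203] -/
theorem eq81a_of_prop22ii {c' : ℝ} (hc' : 0 ≤ c') (h_ii : Skeleton.Prop22ii) : Eq81a c' := by
  intro B C c₀ hc₀
  obtain ⟨D₁, h⟩ := h_ii
  refine ⟨max (max D₁ 3) ⌈Real.exp (max 2 (max (5 * π * c' + 1) (π * (|C| + c₀ + 1) + 1)))⌉₊,
    fun D _ χ hD hq hp _ a₁ a₂ _ _ x hx Lm Lp hR => ?_⟩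
  have hD₁ : D₁ ≤ D := le_trans (le_trans (le_max_left _ _) (le_max_left _ _)) hD
  have hD3 : 3 ≤ D := le_trans (le_trans (le_max_right _ _) (le_max_left _ _)) hD
  have hL := u003W_threshold_le_ell (le_trans (le_max_right _ _) hD)
  have hℓ2 : 2 ≤ ell D := le_trans (le_max_left _ _) hL
  have hℓc : 5 * π * c' + 1 ≤ ell D := le_trans (le_trans (le_max_left _ _) (le_max_right _ _)) hL
  have hℓC : π * (|C| + c₀ + 1) + 1 ≤ ell D :=
    le_trans (le_trans (le_max_right _ _) (le_max_right _ _)) hL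
  have e_ii := h D χ hD₁ hq hp
  have hα_eq : alpha D = π / ell D ^ 9 := by rw [alpha, bigP, Real.log_exp]
  have hℓpos : 0 < ell D := by linarith
  have hα : 0 < alpha D := by rw [hα_eq]; positivity
  have hℓ9 : ell D ≤ ell D ^ 9 := le_self_pow₀ (by linarith) (by norm_num)
  have hαℓ : alpha D * ell D ≤ π := by
    rw [hα_eq, div_mul_eq_mul_div, div_le_iff₀ (by positivity)]
    nlinarith [Real.pi_pos]
  obtain ⟨h5, -⟩ := u003W_alpha_small hℓ2 hℓc
  have hcαℓ : 0 ≤ c' * alpha D * ell D := by positivity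
  have hb1 : 0 ≤ (beta1 c' D).im := by
    have : (beta1 c' D).im = alpha D * (1 - 5 * c' * alpha D * ell D) := by simp [beta1]
    rw [this]; exact mul_nonneg hα.le (by linarith)
  have hb2 : 0 ≤ (beta2 c' D).im := by
    have : (beta2 c' D).im = 2 * alpha D * (1 + c' * alpha D * ell D) := by simp [beta2]
    rw [this]; positivity
  have hb3 : 0 ≤ (beta3 c' D).im := by
    have : (beta3 c' D).im = 3 * alpha D * (1 - c' * alpha D * ell D) := by simp [beta3]
    rw [this]; exact mul_nonneg (by positivity) (by linarith)
  have hCα : (|C| + c₀ + 1) * alpha D < 1 := by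
    have h1 : alpha D ≤ π / ell D := by
      rw [hα_eq]; exact div_le_div_of_nonneg_left Real.pi_pos.le hℓpos hℓ9
    have h2 : π / ell D * (π * (|C| + c₀ + 1) + 1) ≤ π := by
      rw [div_mul_eq_mul_div, div_le_iff₀ hℓpos]; nlinarith [Real.pi_pos]
    have h3 : 0 ≤ |C| + c₀ + 1 := by positivity
    nlinarith [Real.pi_gt_three]
  have hLp1 := hR.1
  have hLm1 := hR.2.1
  have hℓ : 1 < ell D := by linarith
  have hℓ1 : 1 ≤ ell1 D := one_le_pow₀ hℓ.le
  have ht0 : ell1 D ≤ t0 D := pow_le_pow_right₀ hℓ.le (by norm_num)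
  have hCabs : C * alpha D ≤ |C| * alpha D := mul_le_mul_of_nonneg_right (le_abs_self C) hα.le
  have hLp := abs_le.mp hLp1
  have hLm := abs_le.mp hLm1
  have hc₀α : c₀ * alpha D < 1 := by nlinarith [abs_nonneg C]
  have hCα1 : |C| * alpha D < 1 := by nlinarith [abs_nonneg C]
  have hLmLp : Lm < Lp := by linarith
  have hLmpos : c₀ * alpha D < 2 * π * t0 D + Lm := by nlinarith [Real.pi_gt_three]
  exact eq81a_at χ hD3 hp c' x a₁ a₂ hb1 hb2 hb3 hc₀ hα hLmpos hLmLp (fun s hs => e_ii x hx s hs) hR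

/-- **`Z22:(8.1)`, first equality, from the windowed Proposition 2.2** (`Skeleton.Prop22W c′`):
`Section8aStatements.Eq81a c′`, for every `c′ ≥ 0`. [cite: Zhang2022LandauSiegel, §8 (8.1) p. 42] -/
theorem eq81a_of_prop22W {c' : ℝ} (hc' : 0 ≤ c') (h22 : Skeleton.Prop22W c') : Eq81a c' :=
  eq81a_of_prop22ii hc' h22.2.1

/-! ## Append (sz-d02 gen 2): the third Proposition-2.2 input of the chain, `Z22:§8.u016` -/

/-- **`Z22:§8.u016` from the windowed Proposition 2.2** (`Skeleton.Prop22W c′`): the last display of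
the proof of Lemma 8.1 ("`Σ_{ψ∈Ψ₁}|I₁^±(𝐚₁,𝐚₂;ψ)| = o(𝔓)`", [Z22 p.44, tex L2251–L2257]) uses
Proposition 2.2 (i) only — sz-d06's `Step8u016.step8u016_of : Prop22i → ∀ c′, Step8u016 c′` — and
`Prop22W` carries (i) verbatim (`Prop22W.1`). With `step8u003_of_prop22W` and `eq81a_of_prop22W`
above, these are the three Prop-2.2-shaped leaves of sz-d22's `lemma81_of_leaves'` that do not pass
through Lemma 5.9. [cite: Zhang2022LandauSiegel, §8 p. 44, tex L2251–L2257] -/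
theorem step8u016_of_prop22W {c' : ℝ} (h22 : Skeleton.Prop22W c') : Step8u016 c' :=
  Step8u016.step8u016_of h22.1 c'

end Literature.NumberTheory.LFunctions.Zhang2022.Section8aStatements
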